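import Summits.BirchSwinnertonDyer.BirchSwinnertonDyer.Theorems.GenusKolyvaginAtTwoShaCardDvdPowAtTwoPosTOnCut
import Summits.BirchSwinnertonDyer.BirchSwinnertonDyer.Theorems.GenusKolyvaginAtTwoPowDvdShaCardAtTwoRTGenusParity
import HarnessLib

/-!
# Route `GenusKolyvaginAtTwo`, crux U⁺_T `ShaCardDvdPowAtTwoPosT` (stmt-BirchSwinnertonDyer-23378), LINE `rational_pair_descent_pos` (LEAD gk2-p1 g20,
# skeleton registered 2026-08-30T01:19Z): the registered stub ONCUT⁺ `stub_onCutPos` PROVED BY NAME AND SIGNATURE — the descent on the cut, SIGN-FREE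

Seat `bsd-line-gk2-p3` g27 (PROVER seat 3/3, cell `bsd-f1-sign2`), `--supports stmt-BirchSwinnertonDyer-23378` (registered stub; closes nothing by itself:
the composition `ShaCardDvdPowAtTwoPosT_of_stubs` still carries Q2, B2Q⁺ and the declared residual).  THEOREM ONLY (no definition, no named fact, no
`sorry`); standard axioms.  BSD is NOT proved by any of this; U⁺_T / Q4_T AS FILED are NOT proved.

WHAT.  `stub_onCutPos` VERBATIM (LEAD's `line23378/rational_pair_descent_pos_v1_gk2p1.lean`): on the frame (non-CM, odd Tamagawa, `K` imaginary quadratic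
with odd `d_K ≠ −3`, Heegner, the two non-squares, `ρ_{E,2^n}` onto, `y_K = P(1)` of infinite order, `2^(M₀+1) ∤ y_K`), GIVEN the B2Q-shape exponent
`2^M₀ · Sel_(2^M)(E/ℚ) = 0` for all `M`, `w(E) = 1`, and a globally minimal `2`-Selmer-minimal model `Wd ≅ E^(d_K)` with `ord₂ C(Wd) = 0`:
`#Ш(E/K)[2^∞] ∣ 2^(2M₀)`.  NO sign hypothesis: on `Δ > 0` it is this seat's `natCard_primaryComponent_sha_two_dvd_pow_onOddTwinCut_of_selmerExponent`
(`…PosTOnCut`, p754542: Kummer ⟹ `rank E(ℚ) = 0`; RANKQ⁺ p754093; sign-free pair sandwich p754092/p754145 with the archimedean bit p752567); on `Δ < 0`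
the hypothesis `ord₂ C(Wd) = 0` is VACUOUSLY FALSE by the genus parity (`odd_padicValNat_two_tamagawaProduct_twin_of_Δ_neg`, gk2-p3 g14/g17: the ramified
part of `ord₂ C(Wd)` is odd on `Δ < 0`); `Δ ≠ 0` for an elliptic curve.  Unused binders of the registered signature: `¬CM`, `d_K ≠ −3`, the two non-squares,
`2^M₀ ∣ P(1)`, `[Wd.IsGloballyMinimal]`.

References: [Kramer1981] Thm. 1, §2 Prop. 3; [MazurRubin2010] Cor. 3.4 (i); [GrossLMS1991] §5 Prop. 5.3; [Kolyvagin1989Izv] Thm. B₂; [MilneADT2006] I §6.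
-/

set_option linter.dupNamespace false
set_option autoImplicit false

noncomputable section

namespace Summit.BirchSwinnertonDyer.BirchSwinnertonDyer.Theorems.GenusExact.RationalPairDescentPos

open scoped Classical
open WeierstrassCurve NumberField IsDedekindDomain Field
open Literature.NumberTheory.GaloisRepresentations Literature.NumberTheory.EllipticCurves
open Literature.NumberTheory.EllipticCurves.ModularForms
open Literature.NumberTheory
open Summit.BirchSwinnertonDyer.BirchSwinnertonDyer.Theses.GenusKolyvaginAtTwo
open Summit.BirchSwinnertonDyer.BirchSwinnertonDyer.Theorems.GenusExact.PlusDescent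

/-- **stub ONCUT⁺ `stub_onCutPos` of LINE `rational_pair_descent_pos` (crux U⁺_T, stmt-BirchSwinnertonDyer-23378), PROVED — the descent on the cut,
sign-free**: from the B2Q-shape exponent `2^M₀ · Sel_(2^M)(E/ℚ) = 0` (all `M`), `w(E) = 1` and a globally minimal `2`-Selmer-minimal model `Wd ≅ E^(d_K)`
with `ord₂ C(Wd) = 0`, on the frame: `#Ш(E/K)[2^∞] ∣ 2^(2M₀)`.  `Δ > 0`: `natCard_primaryComponent_sha_two_dvd_pow_onOddTwinCut_of_selmerExponent`;
`Δ < 0`: vacuous (`ord₂ C(Wd)` is odd by the genus parity).  [cite: Kramer1981, Thm. 1, §2 Prop. 3] [cite: MazurRubin2010, Cor. 3.4 (i)]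
[cite: GrossLMS1991, §5 Prop. 5.3] [cite: Kolyvagin1989Izv, Thm. B₂] -/
theorem stub_onCutPos :
    ∀ (W : WeierstrassCurve ℚ) [W.IsElliptic] [W.IsGloballyMinimal] [NeZero (W.conductorNorm ℤ)], ¬ W.HasCM → Odd W.tamagawaProduct →
    ∀ (K : Type) [Field K] [NumberField K], IsImaginaryQuadratic K → Odd (NumberField.discr K) → NumberField.discr K ≠ -3 →
      SatisfiesHeegnerHypothesis (W.conductorNorm ℤ) K →
      ¬ IsSquare ((NumberField.discr K : ℚ) * -|W.Δ|) → ¬ IsSquare ((NumberField.discr K : ℚ) * (-(2 * |W.Δ|))) →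
      (∀ n : ℕ, 0 < n → W.HasSurjectiveModNGaloisRep ((2 : ℤ) ^ n)) →
    ∀ (Dt : ModularParametrizationData W (W.conductorNorm ℤ)) (β : ℤ) (ι : K →+* ℂ) (d₁ : KolyvaginHeegnerData Dt β ι 1),
      ¬ IsOfFinAddOrder d₁.derivedPoint → ∀ (M₀ : ℕ),
      (∃ Q : (W.baseChange (ringClassField K ι 1)).toAffine.Point, ((2 ^ M₀ : ℕ) : ℤ) • Q = d₁.derivedPoint) →
      (¬ ∃ Q : (W.baseChange (ringClassField K ι 1)).toAffine.Point, ((2 ^ (M₀ + 1) : ℕ) : ℤ) • Q = d₁.derivedPoint) →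
      (∀ (M : ℕ) (s₀ : galH1Torsion W ((2 ^ M : ℕ) : ℤ)), s₀ ∈ selmerGroup W ((2 ^ M : ℕ) : ℤ) → ((2 ^ M₀ : ℕ) : ℤ) • s₀ = 0) →
      W.rootNumber = 1 → ∀ (Wd : WeierstrassCurve ℚ) [Wd.IsElliptic] [Wd.IsGloballyMinimal],
        (∃ C : WeierstrassCurve.VariableChange ℚ, C • W.quadraticTwist (NumberField.discr K : ℚ) = Wd) →
        Nat.card (Wd.selmerGroup 2) = 2 → padicValNat 2 Wd.tamagawaProduct = 0 →
        Nat.card (AddCommGroup.primaryComponent (W.baseChange K).sha 2) ∣ 2 ^ (2 * M₀) := by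
  intro W _ _ _ _hcm hT K _ _ hIQ hodd _h3 hHe _hsq1 _hsq2 hρ Dt β ι d₁ hy M₀ _hdiv hndiv hB2Q hw Wd _ _ hWd hSel hDEF
  have hs2 : W.HasSurjectiveModNGaloisRep 2 := by simpa using hρ 1 one_pos
  rcases lt_trichotomy W.Δ 0 with hneg | h0 | hpos
  · -- `Δ < 0`: `ord₂ C(Wd)` is odd by the genus parity, contradicting `= 0`
    exfalso
    obtain ⟨Cd, hCd⟩ := hWd
    obtain ⟨k, hk⟩ := odd_padicValNat_two_tamagawaProduct_twin_of_Δ_neg W hIQ hodd hHe hT hneg Cd hCd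
    omega
  · -- `Δ ≠ 0` for an elliptic curve
    exfalso
    have hΔ : W.Δ ≠ 0 := by rw [← WeierstrassCurve.coe_Δ']; exact W.Δ'.ne_zero
    exact hΔ h0
  · exact natCard_primaryComponent_sha_two_dvd_pow_onOddTwinCut_of_selmerExponent W K hT hpos hIQ hodd hHe hs2 Dt β ι d₁ hy M₀ hndiv hw Wd hWd
      hSel hDEF hB2Q

end Summit.BirchSwinnertonDyer.BirchSwinnertonDyer.Theorems.GenusExact.RationalPairDescentPos

end
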